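import Mathlib
import HarnessLib
import Summits.HubbardSuperconductivity.HubbardSuperconductivity.Theorems.KLProgrammeKLRegimeEngineTowerLevStepLinkUniformF
import Summits.HubbardSuperconductivity.HubbardSuperconductivity.Theorems.KLProgrammeKLRegimeEngineTowerBlockIncrWtKlEngAll

/-!
# Route `KLProgramme` — crux K3 ENGINE (stmt-HubbardSuperconductivity-20437 `KLRegimeEngineV17F2`), stub (b) v2, THE LEVELS PACKAGE (ℓ), located-risk #10
# residual «(ℓ)-LINK-F-KLENG»: the k-uniform floor LINK ON THE FLOW FRAME `K_n` with the per-block LINK DATA DISCHARGED FROM THE MODEL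
# (cell gate-hubbard-kl, seat hubbard-kl-k3c2-p3 g14; the levelled twin of `klWtPinnedSumAt_klTowerIncr_le_klEng_all` (k3c3-p2 g12) — E1 may rename or supersede)

`levLawF_hstep_of_blockBounds` (…TowerLevStepLinkUniformF, p683037) delivers the floor-keyed law's `hstep` from four k-free bounds on the block data
(`κ_k²·8^{dk} ≤ κ̄²`, `α_k ≤ ᾱ·4^{dk}`, analysis-overlap rows/cols `≤ c̄r, c̄c`).  On the flow frame `K := klFlowFrameU … n` the three model packages of the
weighted lane supply exactly these, block by block:

* Gram (k3c2-p3 `gram_sliceCT_bgmFat_sharp_klEng`): `κ_k = √(Cκ·(Λ_{dk}/Λ_{dk−1})·e₀·8^{−(dk−1)})` ⇒ `κ_k²·8^{dk} = 2·Cκ·e₀` (`Λ_{dk}/Λ_{dk−1} = 1/4`);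
* rows/cols of `S(F̃_{dk−1})ᵀ C^{K_n}_{(Λ_{d(k+1)},Λ_{dk}]} S(F̃_{dk−1})` (k3c3-p2/p3 `alphaWt_towerBlock_klEng_flow_all'`, the weight `klScaleWt ≥ 1` dropped):
  `α_k = Cb·(M/β)/Λ_{d(k+1)} = (Cb·(M/β)·4^d/e₀)·4^{dk}`;
* analysis overlaps of `E(F_{dk})·S(F̃_{dk−1})` (`overlapWt_towerBlock_klEng_flow_all`, weight dropped): `c̄r = 81·CJ·M/β`, `c̄c = 162·CJ·M/β`.

* §0 **`levLawF_hstep_of_blockBounds_tok`** — p683037's `hstep` with the partition-function premise INSIDE the per-block statement (k3c3-p2 g16's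
  tokenised tower induction «(ℓ)-Z-THREAD», in which `Z_{Λ_{dk}} ≠ 0` is the induction's invariant, #18);
* §1 `sum_norm_le_of_sum_norm_mul_klScaleWt_le` (drop a weight `≥ 1`), `klScale_ratio_pred` (`Λ_{j}/Λ_{j−1} = 1/4`), `gramF_sq_mul_pow_eq`, `alphaF_eq_bound_mul_pow`;
* §3 (appended) **`linkDataF_klEng (d R c″)`** — the same eight per-block data as ONE bundle per block `k` (for k3c3-p2 g16's tokenised assembly F6 and Z-step F2);
* §2 **`levLawF_hstep_klEng (d R c″)`** — `∃ Cκ Cb CJ > 0` such that under the v1 doors, the history `HistP … 0 n`, `FrameOK … K_n`, `IsKLRegime U c (−n)` and the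
  (K5′) clauses, for `2 ≤ d` and every `Kb` with `d·Kb ≤ n_β + 1`, `d·Kb ≤ n + d`, given the per-block partition functions `Z^{K_n}_{Λ_{dk}} ≠ 0` and `card/2 ≤ D`,
  the `hstep` text of `klTowerBLevF_le_law_lev_of_doors_of_wgridStep` holds VERBATIM at `K := K_n` with `κ̄ ᾱ c̄r c̄c` and then `W Z σ τ ψ Φ` pinned by EQUATIONS
  (`κ̄ = √(2·Cκ·e₀)`, `ᾱ = Cb·(M/β)·4^d/e₀`, `c̄r = 81·CJ·M/β`, `c̄c = 162·CJ·M/β`; `W = 64·27⁴·e²·c̄r/c̄c`, `Z = e⁴c̄c²ε²/8`, `σ = κ̄²/(e⁴c̄c²)`, `τ = e²κ̄²/c̄c²`,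
  `ψ = e⁴c̄c²/κ̄²`, `Φ = 9ᾱc̄c/(27⁵·e·κ̄²·c̄r)`).
Composition of landed theorems; nothing about the model is asserted beyond them; nothing asserts (ℓ), any stub, K3 or superconductivity.
References: BGM 2006 §2.7 (2.71a), §2.8 (2.76)–(2.84), (2.97)–(2.98), §3 (3.2)–(3.8) [cite: BenfattoGiulianiMastropietro2006].
-/

noncomputable section

namespace Summit.HubbardSuperconductivity.HubbardSuperconductivity.Theorems.EngineV8

set_option linter.dupNamespace false -- summit = problem name (single-conjunct summit), D-0017

open Classical
open Real Finset Literature.MathematicalPhysics.QuantumLattice Literature.Probability.LatticeModels GrassmannAlgebra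
open Literature.MathematicalPhysics.QuantumLattice.FermiRG Literature.MathematicalPhysics.QuantumLattice.FermiRG.BGM2006Routing
open Summit.HubbardSuperconductivity.HubbardSuperconductivity.Theorems.KLProgrammeLegKernels
open Summit.HubbardSuperconductivity.HubbardSuperconductivity.Theorems.KLRegimeSplit
open Summit.HubbardSuperconductivity.HubbardSuperconductivity.Theorems.KLRegimeWick
open Summit.HubbardSuperconductivity.HubbardSuperconductivity.Theorems.TwoPointAssembly
open Summit.HubbardSuperconductivity.HubbardSuperconductivity.Theorems.DispersionFlow
open Summit.HubbardSuperconductivity.HubbardSuperconductivity.Theorems.TorusFourierL2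

variable {L M : ℕ} [NeZero L] [NeZero M]

/-! ## §0 The tokenised `hstep` (partition-function premise inside the per-block statement) -/

/-- **THE k-UNIFORM FLOOR LINK, TOKENISED** (located «(ℓ)-Z-THREAD», k3c3-p2 g16, KL STATUS 2026-08-29): `levLawF_hstep_of_blockBounds` with the
partition-function premise `Z^K_{Λ_{dk}} ≠ 0` moved INSIDE the per-block statement (`∀ t k, 1 ≤ k → k < Kb → Z^K_{Λ_{dk}} ≠ 0 → ∀ N …`) instead of a blanket
hypothesis — the shape of the tokenised tower induction (`Zk k →` premise of `hstep_tok`), in which `Z_{Λ_{dk}} ≠ 0` is the induction's own invariant (#18).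
[cite: BenfattoGiulianiMastropietro2006, §2.8 (2.76)-(2.84), (2.97)-(2.98), §3 (3.2)-(3.8)] -/
theorem levLawF_hstep_of_blockBounds_tok {β : ℝ} (hβ : 0 < β) (U μ : ℝ) (K : TrigPolyC4v) {d : ℕ} (hd : 2 ≤ d) (Kb : ℕ)
    {κb αb crb ccb : ℝ} (hκb : 0 < κb) (hαb : 0 < αb) (hcrb : 0 < crb) (hccb : 0 < ccb)
    (κ α : ℕ → ℝ) (hκ : ∀ k, 1 ≤ k → k < Kb → 0 < κ k) (hκκb : ∀ k, 1 ≤ k → k < Kb → κ k ^ 2 * (8 : ℝ) ^ (d * k) ≤ κb ^ 2)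
    (hααb : ∀ k, 1 ≤ k → k < Kb → α k ≤ αb * (4 : ℝ) ^ (d * k))
    (hGB : ∀ k, 1 ≤ k → k < Kb → IsGramBoundedR ((sectorSubMatrix L M β (bgmFatMultiplier L M klE0 β (nambuXiCT L μ K) (d * k - 1))).transpose *
      hubbardCovSliceCT L M β μ 0 K (klScale klE0 (d * (k + 1))) (klScale klE0 (d * k)) *
        sectorSubMatrix L M β (bgmFatMultiplier L M klE0 β (nambuXiCT L μ K) (d * k - 1))) (κ k))
    (hrow : ∀ k, 1 ≤ k → k < Kb → ∀ X, ∑ Y, ‖((sectorSubMatrix L M β (bgmFatMultiplier L M klE0 β (nambuXiCT L μ K) (d * k - 1))).transpose *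
        hubbardCovSliceCT L M β μ 0 K (klScale klE0 (d * (k + 1))) (klScale klE0 (d * k)) *
          sectorSubMatrix L M β (bgmFatMultiplier L M klE0 β (nambuXiCT L μ K) (d * k - 1))) X Y‖ ≤ α k)
    (hcol : ∀ k, 1 ≤ k → k < Kb → ∀ Y, ∑ X, ‖((sectorSubMatrix L M β (bgmFatMultiplier L M klE0 β (nambuXiCT L μ K) (d * k - 1))).transpose *
        hubbardCovSliceCT L M β μ 0 K (klScale klE0 (d * (k + 1))) (klScale klE0 (d * k)) *
          sectorSubMatrix L M β (bgmFatMultiplier L M klE0 β (nambuXiCT L μ K) (d * k - 1))) X Y‖ ≤ α k)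
    (hrow' : ∀ k, 1 ≤ k → k < Kb → ∀ X'', ∑ X', ‖(sectorAnalysisMatrix L M β (klAnisoFamily L M β μ K klE0 (d * k)) *
        sectorSubMatrix L M β (bgmFatMultiplier L M klE0 β (nambuXiCT L μ K) (d * k - 1))) X'' X'‖ ≤ crb)
    (hcol' : ∀ k, 1 ≤ k → k < Kb → ∀ X', ∑ X'', ‖(sectorAnalysisMatrix L M β (klAnisoFamily L M β μ K klE0 (d * k)) *
        sectorSubMatrix L M β (bgmFatMultiplier L M klE0 β (nambuXiCT L μ K) (d * k - 1))) X'' X'‖ ≤ ccb)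
    {D : ℕ} (hD : ∀ k, 1 ≤ k → k < Kb → Fintype.card (SpaceTimeIdx L M × SectorLeg (sectorCount (d * k - 1))) / 2 ≤ D)
    {W Z σ τ ψ Φ : ℝ}
    (hW : W = 64 * (27 : ℝ) ^ 4 * exp 2 * crb / ccb) (hZ' : Z = exp 4 * ccb ^ 2 * imagTimeWeight β M ^ 2 / 8)
    (hσ : σ = κb ^ 2 / (exp 4 * ccb ^ 2)) (hτ : τ = exp 2 * κb ^ 2 / ccb ^ 2) (hψ : ψ = exp 4 * ccb ^ 2 / κb ^ 2)
    (hΦ : Φ = 9 * αb * ccb / ((27 : ℝ) ^ 5 * exp 1 * κb ^ 2 * crb)) :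
    ∀ t : Fin 5, ∀ k, 1 ≤ k → k < Kb → hubbardEffPartitionFnCT L M β U μ 0 K (klScale klE0 (d * k)) ≠ 0 → ∀ N : ℕ, 2 ≤ N → ∀ p, 3 ≤ p → p ≤ D →
      Φ * towerV D τ (fun m => W * Z ^ m * klTowerMuLevF L M β U μ K d k m) < 1 →
      klTowerBLevF L M β U μ K d t (k + 1) p ≤
        towerFO D σ (fun m => W * Z ^ m * klTowerMuLevF L M β U μ K d k m) p +
          ∑ n ∈ Icc 2 N, exp 1 * Φ ^ (n - 1) * ψ ^ p * towerS D τ (fun m => W * Z ^ m * klTowerMuLevF L M β U μ K d k m) n p +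
          ψ ^ p * exp 1 * towerV D τ (fun m => W * Z ^ m * klTowerMuLevF L M β U μ K d k m) *
            (Φ * towerV D τ (fun m => W * Z ^ m * klTowerMuLevF L M β U μ K d k m)) ^ N /
            (1 - Φ * towerV D τ (fun m => W * Z ^ m * klTowerMuLevF L M β U μ K d k m)) := by
  subst hW hZ' hσ hτ hψ hΦ
  intro t k hk1 hk hZk N hN p hp hpD hguard
  obtain ⟨q, rfl⟩ : ∃ q, p = q + 1 := ⟨p - 1, by omega⟩
  have hN1 : 1 ≤ N := by omega
  have hd1 : 1 ≤ d := by omega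
  have hdk : 2 ≤ d * k := le_trans hd (Nat.le_mul_of_pos_right d hk1)
  exact klTowerBLevF_succ_le_kitStep_of_bounds hβ U μ K hd1 hk1 hdk hZk (hκ k hk1 hk) hκb (hκκb k hk1 hk) (hGB k hk1 hk) hαb
    (hααb k hk1 hk) (hrow k hk1 hk) (hcol k hk1 hk) hcrb hccb (hrow' k hk1 hk) (hcol' k hk1 hk) (hD k hk1 hk) hN1 hguard t q


/-! ## §1 Small rows: dropping a weight `≥ 1`, the scale ratio, the two k-free identities -/

omit [NeZero L] [NeZero M] in
/-- **Dropping the decay weight**: a row sum weighted by `klScaleWt ≥ 1` dominates the unweighted row sum. -/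
theorem sum_norm_le_of_sum_norm_mul_klScaleWt_le {ι : Type*} (s : Finset ι) (f : ι → ℂ) (β : ℝ) (j : ℕ)
    (S : ι → Finset (ZMod (2 * (2 * M)) × TorusSite 2 L)) {a : ℝ} (h : ∑ i ∈ s, ‖f i‖ * klScaleWt L M β j (S i) ≤ a) :
    ∑ i ∈ s, ‖f i‖ ≤ a :=
  le_trans (sum_le_sum fun i _ => le_mul_of_one_le_right (norm_nonneg _) (one_le_klScaleWt L M β j (S i))) h

omit [NeZero L] [NeZero M] in
/-- **One family step quarters the scale**: `Λ_j / Λ_{j−1} = 1/4` (`1 ≤ j`). -/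
theorem klScale_ratio_pred (e₀ : ℝ) (he : 0 < e₀) {j : ℕ} (hj : 1 ≤ j) : klScale e₀ j / klScale e₀ (j - 1) = 1 / 4 := by
  obtain ⟨i, rfl⟩ : ∃ i, j = i + 1 := ⟨j - 1, by omega⟩
  rw [Nat.add_sub_cancel]
  unfold klScale
  rw [pow_succ]
  have h4 : (0 : ℝ) < (4 : ℝ) ^ i := by positivity
  field_simp

omit [NeZero L] [NeZero M] in
/-- **The Gram constant's k-free form**: `κ_k²·8^{dk} = 2·Cκ·e₀` for `κ_k = √(Cκ·(Λ_{dk}/Λ_{dk−1})·e₀·8^{−(dk−1)})` (`1 ≤ dk`, `0 ≤ Cκ`). -/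
theorem gramF_sq_mul_pow_eq {Cκ : ℝ} (hC : 0 ≤ Cκ) {d k : ℕ} (hdk : 1 ≤ d * k) :
    Real.sqrt (Cκ * (klScale klE0 (d * k) / klScale klE0 (d * k - 1)) * (klE0 * ((8 : ℝ) ^ (d * k - 1))⁻¹)) ^ 2 * (8 : ℝ) ^ (d * k) =
      Real.sqrt (2 * Cκ * klE0) ^ 2 := by
  have he : (0 : ℝ) < klE0 := by norm_num [klE0]
  rw [klScale_ratio_pred klE0 he hdk, Real.sq_sqrt (by positivity), Real.sq_sqrt (by positivity)]
  obtain ⟨i, hi⟩ : ∃ i, d * k = i + 1 := ⟨d * k - 1, by omega⟩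
  rw [hi, Nat.add_sub_cancel, pow_succ]
  have h8 : (0 : ℝ) < (8 : ℝ) ^ i := by positivity
  field_simp
  ring

omit [NeZero L] [NeZero M] in
/-- **The decay constant's k-free form**: `Cb·(M/β)/Λ_{d(k+1)} = (Cb·(M/β)·4^d/e₀)·4^{dk}`. -/
theorem alphaF_eq_bound_mul_pow (Cb x : ℝ) (d k : ℕ) :
    Cb * x / klScale klE0 (d * (k + 1)) = Cb * x * (4 : ℝ) ^ d / klE0 * (4 : ℝ) ^ (d * k) := by
  have he : (0 : ℝ) < klE0 := by norm_num [klE0]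
  unfold klScale
  rw [Nat.mul_succ, pow_add]
  field_simp

/-! ## §2 The `hstep` binder on the flow frame, LINK data from the model -/

/-- **THE k-UNIFORM FLOOR LINK ON THE FLOW FRAME, LINK DATA DISCHARGED, TOKENISED** («(ℓ)-LINK-F-KLENG», Z-thread shape): as `levLawF_hstep_klEng`
below but with the per-block partition-function premise `Z^{K_n}_{Λ_{dk}} ≠ 0` INSIDE the per-block statement (k3c3-p2 g16's tokenised induction, #18).
[cite: BenfattoGiulianiMastropietro2006, §2.8 (2.76)-(2.84), §3 (3.2)-(3.8)] -/
theorem levLawF_hstep_klEng_tok (d : ℕ) (R : RenConsts) (c'' : ℝ) (hc'' : 0 < c'') :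
    ∃ Cκ Cb CJ : ℝ, 0 < Cκ ∧ 0 < Cb ∧ 0 < CJ ∧
      ∀ (G : GeoConsts) (P : SplitConsts) (Q : EngConsts) (c : ℝ), P.WF → R.WF2 → 0 < c → c ≤ klEngC₃6 P R →
      ∀ μ ∈ klWindowC, ∀ U : ℝ, 0 < U → U ≤ klEngU₀9 P R c → c'' * U ≤ 1 →
      ∀ β : ℝ, klBetaMin ≤ β → β ≤ Real.exp (c / U ^ 2) →
      ∀ (L M : ℕ) [NeZero L] [NeZero M], klEngL₃ β U ≤ L → klEngM₃ β U L ≤ M →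
      ∀ n : ℕ, 1 ≤ n → n ≤ nScales β + 1 → IsKLRegime U c (-(n : ℤ)) →
        HistP klPredsV17F2 L M G P Q R β U μ 0 n → FrameOK R U (nScales β) μ (klFlowFrameU L M β U μ n) →
        (∀ m, 1 ≤ m → m < n → FlowPieceOscAt L M c'' β U μ m) →
      2 ≤ d → ∀ Kb : ℕ, d * Kb ≤ nScales β + 1 → d * Kb ≤ n + d →
      ∀ D : ℕ, (∀ k, 1 ≤ k → k < Kb → Fintype.card (SpaceTimeIdx L M × SectorLeg (sectorCount (d * k - 1))) / 2 ≤ D) →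
      ∀ (κb αb crb ccb : ℝ), κb = Real.sqrt (2 * Cκ * klE0) → αb = Cb * ((M : ℝ) / β) * (4 : ℝ) ^ d / klE0 →
        crb = 81 * CJ * M / β → ccb = 162 * CJ * M / β →
      ∀ (W Z σ τ ψ Φ : ℝ),
        W = 64 * (27 : ℝ) ^ 4 * exp 2 * crb / ccb → Z = exp 4 * ccb ^ 2 * imagTimeWeight β M ^ 2 / 8 →
        σ = κb ^ 2 / (exp 4 * ccb ^ 2) → τ = exp 2 * κb ^ 2 / ccb ^ 2 → ψ = exp 4 * ccb ^ 2 / κb ^ 2 →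
        Φ = 9 * αb * ccb / ((27 : ℝ) ^ 5 * exp 1 * κb ^ 2 * crb) →
      ∀ t : Fin 5, ∀ k, 1 ≤ k → k < Kb →
        hubbardEffPartitionFnCT L M β U μ 0 (klFlowFrameU L M β U μ n) (klScale klE0 (d * k)) ≠ 0 → ∀ N : ℕ, 2 ≤ N → ∀ p, 3 ≤ p → p ≤ D →
        Φ * towerV D τ (fun m => W * Z ^ m * klTowerMuLevF L M β U μ (klFlowFrameU L M β U μ n) d k m) < 1 →
        klTowerBLevF L M β U μ (klFlowFrameU L M β U μ n) d t (k + 1) p ≤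
          towerFO D σ (fun m => W * Z ^ m * klTowerMuLevF L M β U μ (klFlowFrameU L M β U μ n) d k m) p +
            ∑ n' ∈ Icc 2 N, exp 1 * Φ ^ (n' - 1) * ψ ^ p * towerS D τ (fun m => W * Z ^ m * klTowerMuLevF L M β U μ (klFlowFrameU L M β U μ n) d k m) n' p +
            ψ ^ p * exp 1 * towerV D τ (fun m => W * Z ^ m * klTowerMuLevF L M β U μ (klFlowFrameU L M β U μ n) d k m) *
              (Φ * towerV D τ (fun m => W * Z ^ m * klTowerMuLevF L M β U μ (klFlowFrameU L M β U μ n) d k m)) ^ N /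
              (1 - Φ * towerV D τ (fun m => W * Z ^ m * klTowerMuLevF L M β U μ (klFlowFrameU L M β U μ n) d k m)) := by
  obtain ⟨Cκ, hCκ, hg⟩ := gram_sliceCT_bgmFat_sharp_klEng
  obtain ⟨Cb, hCb, hαp⟩ := alphaWt_towerBlock_klEng_flow_all' d R c'' hc''
  obtain ⟨CJ, hCJ, hop⟩ := overlapWt_towerBlock_klEng_flow_all d R c'' hc''.le
  refine ⟨Cκ, Cb, CJ, hCκ, hCb, hCJ, ?_⟩
  intro G P Q c hP hR2 hc hc6 μ hμ U hU hU9 hcU β hβmin hβc L M _ _ hL3 hM3 n hn1 hnN hreg hhist hfr hosc hd Kb hKbN hKbn D hD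
    κb αb crb ccb hκb hαb hcrb hccb W Z σ τ ψ Φ hW hZ' hσ hτ hψ hΦ
  have he : (0 : ℝ) < klE0 := by norm_num [klE0]
  have hβ : 0 < β := KLRegimeSplit.pos_of_klBetaMin_le hβmin
  have hM0 : (0 : ℝ) < M := Nat.cast_pos.2 (Nat.pos_of_ne_zero (NeZero.ne M))
  -- doors of the three packages below the v1 binder `U ≤ klEngU₀9`
  have hU4 : U ≤ klEngU₀4 P R c := hU9.trans (klEngU₀9_le_klEngU₀4 P R c)
  have hU3g : U ≤ min (klEngU₀3 P R c) (1 / (R.Gfr 3 + 1)) :=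
    le_min (hU9.trans (klEngU₀9_le_klEngU₀3 P R c)) (hU9.trans (klEngU₀9_le_inv_gfr_add_one P hR2.wf c (by norm_num)))
  have hc3 : c ≤ klEngC₃3 P R := hc6.trans (klEngC₃6_le_klEngC₃3 P R)
  set K : TrigPolyC4v := klFlowFrameU L M β U μ n with hKdef
  -- the four k-free constants are positive
  have hκb0 : 0 < κb := by rw [hκb]; exact Real.sqrt_pos.2 (by positivity)
  have hαb0 : 0 < αb := by rw [hαb]; positivity
  have hcrb0 : 0 < crb := by rw [hcrb]; positivity
  have hccb0 : 0 < ccb := by rw [hccb]; positivity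
  -- the per-block data
  have hblk : ∀ k, 1 ≤ k → k < Kb → 2 ≤ d * k ∧ d * (k + 1) ≤ nScales β + 1 ∧ d * k ≤ n := by
    intro k hk1 hk
    refine ⟨le_trans hd (Nat.le_mul_of_pos_right d hk1), le_trans (Nat.mul_le_mul_left d (by omega)) hKbN, ?_⟩
    have h1 : d * k + d ≤ d * Kb := by rw [← Nat.mul_succ]; exact Nat.mul_le_mul_left d (by omega)
    omega
  refine levLawF_hstep_of_blockBounds_tok (L := L) (M := M) hβ U μ K hd Kb hκb0 hαb0 hcrb0 hccb0
    (fun k => Real.sqrt (Cκ * (klScale klE0 (d * k) / klScale klE0 (d * k - 1)) * (klE0 * ((8 : ℝ) ^ (d * k - 1))⁻¹)))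
    (fun k => Cb * ((M : ℝ) / β) / klScale klE0 (d * (k + 1)))
    (fun k hk1 hk => ?_) (fun k hk1 hk => ?_) (fun k hk1 hk => ?_) (fun k hk1 hk => ?_) (fun k hk1 hk => ?_) (fun k hk1 hk => ?_)
    (fun k hk1 hk => ?_) (fun k hk1 hk => ?_) hD hW hZ' hσ hτ hψ hΦ
  · -- `0 < κ_k`
    have h1 : 0 < klScale klE0 (d * k) := klth_klScale_pos _
    have h2 : 0 < klScale klE0 (d * k - 1) := klth_klScale_pos _
    exact Real.sqrt_pos.2 (by positivity)
  · -- `κ_k²·8^{dk} ≤ κ̄²`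
    obtain ⟨hdk, -, -⟩ := hblk k hk1 hk
    rw [hκb, gramF_sq_mul_pow_eq hCκ.le (by omega)]
  · -- `α_k ≤ ᾱ·4^{dk}`
    rw [hαb, alphaF_eq_bound_mul_pow]
  · -- Gram of the fat-sandwiched slice
    obtain ⟨hdk, hkN, -⟩ := hblk k hk1 hk
    have hΛpos : 0 < klScale klE0 (d * (k + 1)) := klth_klScale_pos _
    have hΛle : klScale klE0 (d * (k + 1)) ≤ klScale klE0 (d * k) := klScale_le_klScale he.le (Nat.mul_le_mul_left d (Nat.le_succ k))
    have hΛle' : klScale klE0 (d * k) ≤ klScale klE0 (d * k - 1) := klScale_le_klScale he.le (by omega)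
    obtain ⟨m, hm⟩ : ∃ m, d * k - 1 = m + 1 := ⟨d * k - 2, by omega⟩
    have hmul : d * (k + 1) = d * k + d := Nat.mul_succ d k
    have h := (hg P R c hP hR2 hc hc3 μ hμ U hU hU4 β hβmin hβc K hfr L M hL3 hM3 m (by omega)
      (klScale klE0 (d * (k + 1))) (klScale klE0 (d * k)) hΛpos hΛle (by rw [← hm]; exact hΛle')).2.1
    rw [← hm] at h
    exact h
  · -- rows
    obtain ⟨hdk, hkN, -⟩ := hblk k hk1 hk
    obtain ⟨hrow, -⟩ := hαp G P Q c hR2 hc hc6 μ hμ U hU hU3g hcU β hβmin hβc L M hL3 hM3 n hn1 hnN hreg hhist hosc k hk1 hdk hkN (d * k) le_rfl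
    exact fun X => sum_norm_le_of_sum_norm_mul_klScaleWt_le _ _ β (d * k) _ (hrow X)
  · -- columns
    obtain ⟨hdk, hkN, -⟩ := hblk k hk1 hk
    obtain ⟨-, hcol⟩ := hαp G P Q c hR2 hc hc6 μ hμ U hU hU3g hcU β hβmin hβc L M hL3 hM3 n hn1 hnN hreg hhist hosc k hk1 hdk hkN (d * k) le_rfl
    exact fun Y => sum_norm_le_of_sum_norm_mul_klScaleWt_le _ _ β (d * k) _ (hcol Y)
  · -- analysis-overlap rows
    obtain ⟨hdk, -, hkn⟩ := hblk k hk1 hk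
    obtain ⟨hrow', -⟩ := hop G P Q c hR2 hc hc6 μ hμ U hU hU3g hcU β hβmin hβc L M hL3 hM3 n hn1 hnN hreg hhist hosc k (by omega) hkn (d * k) le_rfl
    rw [hcrb]
    exact fun X'' => sum_norm_le_of_sum_norm_mul_klScaleWt_le _ _ β (d * k) _ (hrow' X'')
  · -- analysis-overlap columns
    obtain ⟨hdk, -, hkn⟩ := hblk k hk1 hk
    obtain ⟨-, hcol'⟩ := hop G P Q c hR2 hc hc6 μ hμ U hU hU3g hcU β hβmin hβc L M hL3 hM3 n hn1 hnN hreg hhist hosc k (by omega) hkn (d * k) le_rfl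
    have h2 : (2 : ℝ) ^ (d * k - (d * k - 1)) = 2 := by rw [show d * k - (d * k - 1) = 1 by omega, pow_one]
    rw [hccb]
    intro X'
    have h := sum_norm_le_of_sum_norm_mul_klScaleWt_le _ _ β (d * k) _ (hcol' X')
    rw [h2] at h
    exact h.trans (le_of_eq (by ring))

/-- **THE k-UNIFORM FLOOR LINK ON THE FLOW FRAME, LINK DATA DISCHARGED** («(ℓ)-LINK-F-KLENG»): `∃ Cκ Cb CJ > 0` such that, under the v1 doors, an admissible
history at scale `n` (`HistP … 0 n`, `FrameOK … K_n`, `IsKLRegime U c (−n)`, the (K5′) clauses `∀ m, 1 ≤ m → m < n → FlowPieceOscAt … c″ … m`, `c″U ≤ 1`),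
`2 ≤ d`, every block count `Kb` with `d·Kb ≤ n_β + 1` and `d·Kb ≤ n + d`, the per-block partition functions `Z^{K_n}_{Λ_{dk}} ≠ 0` (`1 ≤ k < Kb`) and a degree cap
`D ≥ card/2`: with `κ̄ ᾱ c̄r c̄c` and then `W Z σ τ ψ Φ` pinned by equations to the model expressions of the module docstring, the `hstep` binder of
`klTowerBLevF_le_law_lev_of_doors_of_wgridStep` holds at `K := klFlowFrameU … n`. [cite: BenfattoGiulianiMastropietro2006, §2.8 (2.76)-(2.84), §3 (3.2)-(3.8)] -/
theorem levLawF_hstep_klEng (d : ℕ) (R : RenConsts) (c'' : ℝ) (hc'' : 0 < c'') :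
    ∃ Cκ Cb CJ : ℝ, 0 < Cκ ∧ 0 < Cb ∧ 0 < CJ ∧
      ∀ (G : GeoConsts) (P : SplitConsts) (Q : EngConsts) (c : ℝ), P.WF → R.WF2 → 0 < c → c ≤ klEngC₃6 P R →
      ∀ μ ∈ klWindowC, ∀ U : ℝ, 0 < U → U ≤ klEngU₀9 P R c → c'' * U ≤ 1 →
      ∀ β : ℝ, klBetaMin ≤ β → β ≤ Real.exp (c / U ^ 2) →
      ∀ (L M : ℕ) [NeZero L] [NeZero M], klEngL₃ β U ≤ L → klEngM₃ β U L ≤ M →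
      ∀ n : ℕ, 1 ≤ n → n ≤ nScales β + 1 → IsKLRegime U c (-(n : ℤ)) →
        HistP klPredsV17F2 L M G P Q R β U μ 0 n → FrameOK R U (nScales β) μ (klFlowFrameU L M β U μ n) →
        (∀ m, 1 ≤ m → m < n → FlowPieceOscAt L M c'' β U μ m) →
      2 ≤ d → ∀ Kb : ℕ, d * Kb ≤ nScales β + 1 → d * Kb ≤ n + d →
      (∀ k, 1 ≤ k → k < Kb → hubbardEffPartitionFnCT L M β U μ 0 (klFlowFrameU L M β U μ n) (klScale klE0 (d * k)) ≠ 0) →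
      ∀ D : ℕ, (∀ k, 1 ≤ k → k < Kb → Fintype.card (SpaceTimeIdx L M × SectorLeg (sectorCount (d * k - 1))) / 2 ≤ D) →
      ∀ (κb αb crb ccb : ℝ), κb = Real.sqrt (2 * Cκ * klE0) → αb = Cb * ((M : ℝ) / β) * (4 : ℝ) ^ d / klE0 →
        crb = 81 * CJ * M / β → ccb = 162 * CJ * M / β →
      ∀ (W Z σ τ ψ Φ : ℝ),
        W = 64 * (27 : ℝ) ^ 4 * exp 2 * crb / ccb → Z = exp 4 * ccb ^ 2 * imagTimeWeight β M ^ 2 / 8 →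
        σ = κb ^ 2 / (exp 4 * ccb ^ 2) → τ = exp 2 * κb ^ 2 / ccb ^ 2 → ψ = exp 4 * ccb ^ 2 / κb ^ 2 →
        Φ = 9 * αb * ccb / ((27 : ℝ) ^ 5 * exp 1 * κb ^ 2 * crb) →
      ∀ t : Fin 5, ∀ k, 1 ≤ k → k < Kb → ∀ N : ℕ, 2 ≤ N → ∀ p, 3 ≤ p → p ≤ D →
        Φ * towerV D τ (fun m => W * Z ^ m * klTowerMuLevF L M β U μ (klFlowFrameU L M β U μ n) d k m) < 1 →
        klTowerBLevF L M β U μ (klFlowFrameU L M β U μ n) d t (k + 1) p ≤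
          towerFO D σ (fun m => W * Z ^ m * klTowerMuLevF L M β U μ (klFlowFrameU L M β U μ n) d k m) p +
            ∑ n' ∈ Icc 2 N, exp 1 * Φ ^ (n' - 1) * ψ ^ p * towerS D τ (fun m => W * Z ^ m * klTowerMuLevF L M β U μ (klFlowFrameU L M β U μ n) d k m) n' p +
            ψ ^ p * exp 1 * towerV D τ (fun m => W * Z ^ m * klTowerMuLevF L M β U μ (klFlowFrameU L M β U μ n) d k m) *
              (Φ * towerV D τ (fun m => W * Z ^ m * klTowerMuLevF L M β U μ (klFlowFrameU L M β U μ n) d k m)) ^ N /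
              (1 - Φ * towerV D τ (fun m => W * Z ^ m * klTowerMuLevF L M β U μ (klFlowFrameU L M β U μ n) d k m)) := by
  obtain ⟨Cκ, Cb, CJ, hCκ, hCb, hCJ, h⟩ := levLawF_hstep_klEng_tok d R c'' hc''
  refine ⟨Cκ, Cb, CJ, hCκ, hCb, hCJ, ?_⟩
  intro G P Q c hP hR2 hc hc6 μ hμ U hU hU9 hcU β hβmin hβc L M _ _ hL3 hM3 n hn1 hnN hreg hhist hfr hosc hd Kb hKbN hKbn hZ D hD
    κb αb crb ccb hκb hαb hcrb hccb W Z σ τ ψ Φ hW hZ' hσ hτ hψ hΦ t k hk1 hk N hN p hp hpD hguard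
  exact h G P Q c hP hR2 hc hc6 μ hμ U hU hU9 hcU β hβmin hβc L M hL3 hM3 n hn1 hnN hreg hhist hfr hosc hd Kb hKbN hKbn D hD
    κb αb crb ccb hκb hαb hcrb hccb W Z σ τ ψ Φ hW hZ' hσ hτ hψ hΦ t k hk1 hk (hZ k hk1 hk) N hN p hp hpD hguard

/-! ## §3 The per-block LINK data as a bundle (for the tokenised assembly F6 and the Z-step F2) -/

/-- **THE FLOOR LINK's PER-BLOCK DATA ON THE FLOW FRAME, FROM THE MODEL, AS ONE BUNDLE** — for every block `k ≥ 1` with `2 ≤ dk`, `d(k+1) ≤ n_β+1`,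
`dk ≤ n`: the Gram constant `κ_k = √(Cκ·(Λ_{dk}/Λ_{dk−1})·e₀·8^{−(dk−1)})` of the fat-sandwiched slice (positive, k-free form `κ_k²·8^{dk} ≤ (√(2Cκe₀))²`,
`IsGramBoundedR`), the UNWEIGHTED rows/cols `≤ α_k = Cb·(M/β)/Λ_{d(k+1)} ≤ (Cb·(M/β)·4^d/e₀)·4^{dk}`, and the UNWEIGHTED analysis-overlap rows/cols
`≤ 81·CJ·M/β`, `≤ 162·CJ·M/β` — the eight per-block hypotheses of `levLawF_hstep_of_blockBounds[_tok]` / `klTowerBLevF_le_law_lev_of_blocks` (p4, p683206), and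
the block data the Z-step of the tokenised induction consumes, under the v1 doors and an admissible history at scale `n`.
[cite: BenfattoGiulianiMastropietro2006, §2.7 (2.71a), §2.8 (2.77), (2.81)-(2.83)] -/
theorem linkDataF_klEng (d : ℕ) (R : RenConsts) (c'' : ℝ) (hc'' : 0 < c'') :
    ∃ Cκ Cb CJ : ℝ, 0 < Cκ ∧ 0 < Cb ∧ 0 < CJ ∧
      ∀ (G : GeoConsts) (P : SplitConsts) (Q : EngConsts) (c : ℝ), P.WF → R.WF2 → 0 < c → c ≤ klEngC₃6 P R →
      ∀ μ ∈ klWindowC, ∀ U : ℝ, 0 < U → U ≤ klEngU₀9 P R c → c'' * U ≤ 1 →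
      ∀ β : ℝ, klBetaMin ≤ β → β ≤ Real.exp (c / U ^ 2) →
      ∀ (L M : ℕ) [NeZero L] [NeZero M], klEngL₃ β U ≤ L → klEngM₃ β U L ≤ M →
      ∀ n : ℕ, 1 ≤ n → n ≤ nScales β + 1 → IsKLRegime U c (-(n : ℤ)) →
        HistP klPredsV17F2 L M G P Q R β U μ 0 n → FrameOK R U (nScales β) μ (klFlowFrameU L M β U μ n) →
        (∀ m, 1 ≤ m → m < n → FlowPieceOscAt L M c'' β U μ m) →
      ∀ k : ℕ, 1 ≤ k → 2 ≤ d * k → d * (k + 1) ≤ nScales β + 1 → d * k ≤ n →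
        0 < Real.sqrt (Cκ * (klScale klE0 (d * k) / klScale klE0 (d * k - 1)) * (klE0 * ((8 : ℝ) ^ (d * k - 1))⁻¹)) ∧
        Real.sqrt (Cκ * (klScale klE0 (d * k) / klScale klE0 (d * k - 1)) * (klE0 * ((8 : ℝ) ^ (d * k - 1))⁻¹)) ^ 2 * (8 : ℝ) ^ (d * k) ≤ Real.sqrt (2 * Cκ * klE0) ^ 2 ∧
        IsGramBoundedR ((sectorSubMatrix L M β (bgmFatMultiplier L M klE0 β (nambuXiCT L μ (klFlowFrameU L M β U μ n)) (d * k - 1))).transpose * hubbardCovSliceCT L M β μ 0 (klFlowFrameU L M β U μ n) (klScale klE0 (d * (k + 1))) (klScale klE0 (d * k)) * sectorSubMatrix L M β (bgmFatMultiplier L M klE0 β (nambuXiCT L μ (klFlowFrameU L M β U μ n)) (d * k - 1))) (Real.sqrt (Cκ * (klScale klE0 (d * k) / klScale klE0 (d * k - 1)) * (klE0 * ((8 : ℝ) ^ (d * k - 1))⁻¹))) ∧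
        (∀ X, ∑ Y, ‖((sectorSubMatrix L M β (bgmFatMultiplier L M klE0 β (nambuXiCT L μ (klFlowFrameU L M β U μ n)) (d * k - 1))).transpose * hubbardCovSliceCT L M β μ 0 (klFlowFrameU L M β U μ n) (klScale klE0 (d * (k + 1))) (klScale klE0 (d * k)) * sectorSubMatrix L M β (bgmFatMultiplier L M klE0 β (nambuXiCT L μ (klFlowFrameU L M β U μ n)) (d * k - 1))) X Y‖ ≤ Cb * ((M : ℝ) / β) / klScale klE0 (d * (k + 1))) ∧
        (∀ Y, ∑ X, ‖((sectorSubMatrix L M β (bgmFatMultiplier L M klE0 β (nambuXiCT L μ (klFlowFrameU L M β U μ n)) (d * k - 1))).transpose * hubbardCovSliceCT L M β μ 0 (klFlowFrameU L M β U μ n) (klScale klE0 (d * (k + 1))) (klScale klE0 (d * k)) * sectorSubMatrix L M β (bgmFatMultiplier L M klE0 β (nambuXiCT L μ (klFlowFrameU L M β U μ n)) (d * k - 1))) X Y‖ ≤ Cb * ((M : ℝ) / β) / klScale klE0 (d * (k + 1))) ∧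
        Cb * ((M : ℝ) / β) / klScale klE0 (d * (k + 1)) ≤ Cb * ((M : ℝ) / β) * (4 : ℝ) ^ d / klE0 * (4 : ℝ) ^ (d * k) ∧
        (∀ X'', ∑ X', ‖(sectorAnalysisMatrix L M β (klAnisoFamily L M β μ (klFlowFrameU L M β U μ n) klE0 (d * k)) * sectorSubMatrix L M β (bgmFatMultiplier L M klE0 β (nambuXiCT L μ (klFlowFrameU L M β U μ n)) (d * k - 1))) X'' X'‖ ≤ 81 * CJ * M / β) ∧
        (∀ X', ∑ X'', ‖(sectorAnalysisMatrix L M β (klAnisoFamily L M β μ (klFlowFrameU L M β U μ n) klE0 (d * k)) * sectorSubMatrix L M β (bgmFatMultiplier L M klE0 β (nambuXiCT L μ (klFlowFrameU L M β U μ n)) (d * k - 1))) X'' X'‖ ≤ 162 * CJ * M / β) := by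
  obtain ⟨Cκ, hCκ, hg⟩ := gram_sliceCT_bgmFat_sharp_klEng
  obtain ⟨Cb, hCb, hαp⟩ := alphaWt_towerBlock_klEng_flow_all' d R c'' hc''
  obtain ⟨CJ, hCJ, hop⟩ := overlapWt_towerBlock_klEng_flow_all d R c'' hc''.le
  refine ⟨Cκ, Cb, CJ, hCκ, hCb, hCJ, ?_⟩
  intro G P Q c hP hR2 hc hc6 μ hμ U hU hU9 hcU β hβmin hβc L M _ _ hL3 hM3 n hn1 hnN hreg hhist hfr hosc k hk1 hdk hkN hkn
  have he : (0 : ℝ) < klE0 := by norm_num [klE0]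
  have hβ : 0 < β := KLRegimeSplit.pos_of_klBetaMin_le hβmin
  have hM0 : (0 : ℝ) < M := Nat.cast_pos.2 (Nat.pos_of_ne_zero (NeZero.ne M))
  have hU4 : U ≤ klEngU₀4 P R c := hU9.trans (klEngU₀9_le_klEngU₀4 P R c)
  have hU3g : U ≤ min (klEngU₀3 P R c) (1 / (R.Gfr 3 + 1)) :=
    le_min (hU9.trans (klEngU₀9_le_klEngU₀3 P R c)) (hU9.trans (klEngU₀9_le_inv_gfr_add_one P hR2.wf c (by norm_num)))
  have hc3 : c ≤ klEngC₃3 P R := hc6.trans (klEngC₃6_le_klEngC₃3 P R)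
  set K : TrigPolyC4v := klFlowFrameU L M β U μ n with hKdef
  obtain ⟨hrow, hcol⟩ := hαp G P Q c hR2 hc hc6 μ hμ U hU hU3g hcU β hβmin hβc L M hL3 hM3 n hn1 hnN hreg hhist hosc k hk1 hdk hkN (d * k) le_rfl
  obtain ⟨hrow', hcol'⟩ := hop G P Q c hR2 hc hc6 μ hμ U hU hU3g hcU β hβmin hβc L M hL3 hM3 n hn1 hnN hreg hhist hosc k (by omega) hkn (d * k) le_rfl
  refine ⟨?_, ?_, ?_, ?_, ?_, ?_, ?_, ?_⟩
  · have h1 : 0 < klScale klE0 (d * k) := klth_klScale_pos _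
    have h2 : 0 < klScale klE0 (d * k - 1) := klth_klScale_pos _
    exact Real.sqrt_pos.2 (by positivity)
  · rw [gramF_sq_mul_pow_eq hCκ.le (by omega)]
  · have hΛpos : 0 < klScale klE0 (d * (k + 1)) := klth_klScale_pos _
    have hΛle : klScale klE0 (d * (k + 1)) ≤ klScale klE0 (d * k) := klScale_le_klScale he.le (Nat.mul_le_mul_left d (Nat.le_succ k))
    have hΛle' : klScale klE0 (d * k) ≤ klScale klE0 (d * k - 1) := klScale_le_klScale he.le (by omega)
    obtain ⟨m, hm⟩ : ∃ m, d * k - 1 = m + 1 := ⟨d * k - 2, by omega⟩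
    have hmul : d * (k + 1) = d * k + d := Nat.mul_succ d k
    have h := (hg P R c hP hR2 hc hc3 μ hμ U hU hU4 β hβmin hβc K hfr L M hL3 hM3 m (by omega)
      (klScale klE0 (d * (k + 1))) (klScale klE0 (d * k)) hΛpos hΛle (by rw [← hm]; exact hΛle')).2.1
    rw [← hm] at h
    exact h
  · exact fun X => sum_norm_le_of_sum_norm_mul_klScaleWt_le _ _ β (d * k) _ (hrow X)
  · exact fun Y => sum_norm_le_of_sum_norm_mul_klScaleWt_le _ _ β (d * k) _ (hcol Y)
  · rw [alphaF_eq_bound_mul_pow]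
  · exact fun X'' => sum_norm_le_of_sum_norm_mul_klScaleWt_le _ _ β (d * k) _ (hrow' X'')
  · have h2 : (2 : ℝ) ^ (d * k - (d * k - 1)) = 2 := by rw [show d * k - (d * k - 1) = 1 by omega, pow_one]
    intro X'
    have h := sum_norm_le_of_sum_norm_mul_klScaleWt_le _ _ β (d * k) _ (hcol' X')
    rw [h2] at h
    exact h.trans (le_of_eq (by ring))

end Summit.HubbardSuperconductivity.HubbardSuperconductivity.Theorems.EngineV8

end
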